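import Literature.MathematicalPhysics.QuantumLattice.PairCorrelations
import Literature.MathematicalPhysics.QuantumLattice.HubbardWave0PosSemidefProofs
import HarnessLib

/-!
# Pair correlations: proofs and discharges of the named facts of `PairCorrelations`

Trunk T-QLATTICE, family `hubbard` (companion of
`Literature.MathematicalPhysics.QuantumLattice.PairCorrelations`, which states the notions and the
named facts; this file only PROVES — it declares no definition).

## Contents

* the polarised Yang identity `⟨ψ, (P_v)ᴴ P_w ψ⟩ = v† ρ₂ w`
  (`expect_pairAnnihilator_conjTranspose_mul_pairAnnihilator`, pure bilinearity) and the
  discharge `expect_pairAnnihilator_conjTranspose_mul_holds` of Yang's identity;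
* `Δ_g = P_{φ_g}` for *even* form factors (`pairField_eq_pairAnnihilator_of_even`, a reindexing
  of orbital pairs by sites and spins that needs no anticommutation relation) and its `d`-wave
  instance `pairField_eq_pairAnnihilator_dWave` (discharge of `pairField_eq_pairAnnihilator` for
  `dWaveFormFactor`);
* the sum rule `⟨Δ_g† Δ_g⟩ = Σ_{x,y} ⟨(P_x)ᴴ P_y⟩` (`expect_pairField_conjTranspose_mul_holds`,
  `sum_pairFieldCorr_succ`);
* the Gram-form eigenvector bound `λ |⟨v, φ⟩|² ≤ re (φ† ρ φ)` for `ρ v = λ v`, `‖v‖ = 1`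
  (`re_dotProduct_mulVec_ge_of_eigenvector`);
* the contraction bound `‖c_i φ‖ ≤ ‖φ‖` (`norm_toLp_annihilation_mulVec_le`, from
  `numberAt_eq_diagonal` and Wave0's `PosSemidefTrace.expect_conjTranspose_mul`), hence
  `‖P_x ψ‖ ≤ C_g ‖ψ‖` and `G_L(x,y) ≤ C_g²`
  (`pairFieldCorr_succ_le`);
* `HasTorusLRO` from eventual two-sided bounds (`hasTorusLRO_of_eventually_le`);
* the discharge **`hasPairFieldLRO_dWave_of_hasODLRO_holds`** of the Q-D5 bridge
  `hasPairFieldLRO_dWave_of_hasODLRO`: for `L` in the eventual range of the hypotheses,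
  `Σ_{x,y} G_{L+1}(x,y) = re ⟨Δ_d† Δ_d⟩ = re (φ_d† ρ₂ φ_d) ≥ λ |⟨v, φ_d⟩|² ≥ c² δ (L+1)⁴`;
* the discharge **`hasPairFieldLRO_iff_liminf_holds`** of the unfolding lemma
  `hasPairFieldLRO_iff_liminf`: the `HasTorusLRO` sequence of `pairFieldCorr g ψ` at side `L + 1`
  is `(L+1)⁻⁴ re ⟨Δ_g† Δ_g⟩` (`torusLROSeq_pairFieldCorr_succ`), so the two `liminf`s coincide
  after the index shift `Filter.liminf_nat_add` (`liminf_torusLROSeq_pairFieldCorr`);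
* the discharge **`Matrix.rayleigh_le_supRayleigh_holds`** of `Matrix.rayleigh_le_supRayleigh`:
  for a unit vector `v† v = 1` every component has `‖v i‖ ≤ 1`, so
  `re (v† ρ v) ≤ Σ_{i,j} ‖ρ i j‖` (`Matrix.re_star_dotProduct_mulVec_le_sum_norm`); the range of
  Rayleigh quotients is therefore bounded above (`Matrix.bddAbove_range_rayleigh`) and
  `Matrix.supRayleigh` dominates each of them by `le_ciSup`.

## Sources

C. N. Yang, *Concept of off-diagonal long-range order and the quantum phases of liquid He and of
superconductors*, Rev. Mod. Phys. 34 (1962) 694, §§3–4 (eq. (22): `ρ₂` as a Gram matrix; the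
largest eigenvalue of `ρ₂` bounds pair correlations); D. J. Scalapino, *The case for
d_{x²-y²} pairing in the cuprate superconductors*, Phys. Rep. 250 (1995) 329, §2,
eq. (2.2)–(2.4) (the `d`-wave pair field `Δ_d`, its pair wavefunction and the pair-field
correlation function); S. Friedli, Y. Velenik, *Statistical Mechanics of Lattice Systems*
(CUP 2017), §3.1, §3.7.2 (tori, long-range order bookkeeping); O. Bratteli, D. W. Robinson,
*Operator Algebras and Quantum Statistical Mechanics 2*, §5.2.2 (`‖a(f)‖ = ‖f‖`).

## Design notes

* No definition is introduced: the `e`-components of the pair wavefunction, the norm constant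
  `C_g = Σ_{e ∈ {0} ∪ unitSteps} 2 |g e|/√2` and the map `u ↦ P_u ψ` appear as explicit terms.
* Evenness `g (-e) = g e` (true for `sWave`, `extendedSWave`, `dWaveFormFactor`) is what makes
  `Δ_g = P_{φ_g}` a pure reindexing; for a general `g` the identity would need the CAR.
-/

noncomputable section

namespace Literature.MathematicalPhysics.QuantumLattice

open Matrix Finset Filter Literature.Probability.LatticeModels
open scoped ComplexOrder InnerProductSpace

section ExpectAlgebra

variable {ι : Type*} [Fintype ι]

/-- `A ↦ ⟨ψ, A ψ⟩` is additive. Yang, Rev. Mod. Phys. 34 (1962) 694, §3. [folklore] -/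
theorem expect_add (A B : Matrix (Finset ι) (Finset ι) ℂ) (ψ : Fock ι) :
    expect (A + B) ψ = expect A ψ + expect B ψ := by
  simp [QuantumLattice.expect, add_mulVec, dotProduct_add]

/-- `A ↦ ⟨ψ, A ψ⟩` is homogeneous. Yang, Rev. Mod. Phys. 34 (1962) 694, §3. [folklore] -/
theorem expect_smul (c : ℂ) (A : Matrix (Finset ι) (Finset ι) ℂ) (ψ : Fock ι) :
    expect (c • A) ψ = c * expect A ψ := by
  simp [QuantumLattice.expect, smul_mulVec, dotProduct_smul]

/-- `A ↦ ⟨ψ, A ψ⟩` commutes with finite sums. Yang, Rev. Mod. Phys. 34 (1962) 694, §3. [folklore] -/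
theorem expect_sum {α : Type*} (s : Finset α) (A : α → Matrix (Finset ι) (Finset ι) ℂ)
    (ψ : Fock ι) : expect (∑ a ∈ s, A a) ψ = ∑ a ∈ s, expect (A a) ψ := by
  simp [QuantumLattice.expect, sum_mulVec, dotProduct_sum]

variable [LinearOrder ι]

/-- The polarised form of Yang's identity: `⟨ψ, (P_v)ᴴ P_w ψ⟩ = v† ρ₂ w` (pure bilinearity, no
anticommutation relations needed). Yang, Rev. Mod. Phys. 34 (1962) 694, §4, eq. (22). [folklore] -/
theorem expect_pairAnnihilator_conjTranspose_mul_pairAnnihilator (v w : ι × ι → ℂ) (ψ : Fock ι) :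
    expect ((pairAnnihilator v)ᴴ * pairAnnihilator w) ψ =
      star v ⬝ᵥ (twoParticleRDM ψ *ᵥ w) := by
  simp only [pairAnnihilator, conjTranspose_sum, conjTranspose_smul, conjTranspose_mul,
    annihilation_conjTranspose, Finset.sum_mul, Finset.mul_sum, smul_mul_assoc, mul_smul_comm,
    expect_sum, expect_smul]
  rw [Finset.sum_comm]
  simp only [dotProduct, mulVec, twoParticleRDM, Finset.mul_sum, Pi.star_apply, mul_assoc]
  refine Finset.sum_congr rfl fun p _ => Finset.sum_congr rfl fun q _ => ?_
  ring

/-- Discharge of the named fact `expect_pairAnnihilator_conjTranspose_mul` (Yang's identity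
`⟨ψ, (P_v)ᴴ P_v ψ⟩ = v† ρ₂ v`).
Yang, Rev. Mod. Phys. 34 (1962) 694, §4, eq. (22). [cite: Yang1962, §4] -/
theorem expect_pairAnnihilator_conjTranspose_mul_holds :
    expect_pairAnnihilator_conjTranspose_mul (ι := ι) :=
  fun v ψ => expect_pairAnnihilator_conjTranspose_mul_pairAnnihilator v v ψ

end ExpectAlgebra

section EigenBound

variable {n m : Type*} [Fintype n] [Fintype m]

/-- **Eigenvector lower bound for a Gram form.** If `x† ρ y = ⟨T x, T y⟩` for a linear map `T`
(given as a function with `hTadd`, `hTsmul`)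
(so `ρ` is a positive semidefinite Gram matrix), `v` is a unit vector with `ρ v = λ v`, then
`λ |⟨v, φ⟩|² ≤ re (φ† ρ φ)` for every `φ`: writing `φ = ⟨v, φ⟩ v + w` with `w ⊥ v` one has
`⟨T v, T w⟩ = conj (w† ρ v) = 0`, hence `φ† ρ φ = |⟨v, φ⟩|² λ + ‖T w‖²`.
Yang, Rev. Mod. Phys. 34 (1962) 694, §4 (the largest eigenvalue of `ρ₂` bounds pair
correlations from below). [folklore] -/
theorem re_dotProduct_mulVec_ge_of_eigenvector (T : (n → ℂ) → (m → ℂ))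
    (hTadd : ∀ x y, T (x + y) = T x + T y) (hTsmul : ∀ (c : ℂ) x, T (c • x) = c • T x)
    (ρ : Matrix n n ℂ) (hρ : ∀ x y : n → ℂ, star x ⬝ᵥ (ρ *ᵥ y) = star (T x) ⬝ᵥ (T y))
    (v φ : n → ℂ) (ev : ℝ)
    (hv1 : star v ⬝ᵥ v = 1) (hev : ρ *ᵥ v = (ev : ℂ) • v) :
    ev * ‖star v ⬝ᵥ φ‖ ^ 2 ≤ (star φ ⬝ᵥ (ρ *ᵥ φ)).re := by
  set a : ℂ := star v ⬝ᵥ φ with ha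
  set w : n → ℂ := φ - a • v with hw
  have hφ : φ = a • v + w := by simp [hw]
  have hvw : star v ⬝ᵥ w = 0 := by
    simp [hw, dotProduct_sub, dotProduct_smul, hv1, ha]
  have hwv : star w ⬝ᵥ v = 0 := by
    rw [star_dotProduct, hvw, star_zero]
  have hBwv : star (T w) ⬝ᵥ (T v) = 0 := by
    rw [← hρ, hev, dotProduct_smul, hwv, smul_zero]
  have hBvw : star (T v) ⬝ᵥ (T w) = 0 := by
    rw [star_dotProduct, hBwv, star_zero]
  have hBvv : star (T v) ⬝ᵥ (T v) = ev := by
    rw [← hρ, hev, dotProduct_smul, hv1, smul_eq_mul, mul_one]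
  have hTφ : T φ = a • T v + T w := by
    conv_lhs => rw [hφ]
    rw [hTadd, hTsmul]
  have hmain : star φ ⬝ᵥ (ρ *ᵥ φ) = star a * a * ev + star (T w) ⬝ᵥ (T w) := by
    rw [hρ, hTφ, star_add, star_smul, add_dotProduct, dotProduct_add, dotProduct_add,
      smul_dotProduct, smul_dotProduct, dotProduct_smul, dotProduct_smul, hBvv, hBvw, hBwv]
    simp only [smul_eq_mul, mul_zero, add_zero, zero_add]
    ring
  have hnonneg : 0 ≤ (star (T w) ⬝ᵥ (T w)).re := by
    have h := dotProduct_star_self_nonneg (T w)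
    rw [Complex.le_def] at h
    simpa using h.1
  have haa : (star a * a * (ev : ℂ)).re = ev * ‖a‖ ^ 2 := by
    rw [Complex.star_def, Complex.conj_mul']
    norm_cast
    ring
  rw [hmain, Complex.add_re, haa]
  linarith

end EigenBound

section Geminal

variable {ι : Type*} [LinearOrder ι] [Fintype ι]

/-- `v ↦ P_v` commutes with finite sums. Yang, Rev. Mod. Phys. 34 (1962) 694, §4. [folklore] -/
theorem pairAnnihilator_sum {α : Type*} (s : Finset α) (f : α → ι × ι → ℂ) :
    pairAnnihilator (∑ a ∈ s, f a) = ∑ a ∈ s, pairAnnihilator (f a) := by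
  simp only [pairAnnihilator, Finset.sum_apply, Finset.sum_smul]
  exact Finset.sum_comm

/-- `v ↦ P_v` is additive. Yang, Rev. Mod. Phys. 34 (1962) 694, §4. [folklore] -/
theorem pairAnnihilator_add (v w : ι × ι → ℂ) :
    pairAnnihilator (v + w) = pairAnnihilator v + pairAnnihilator w := by
  simp only [pairAnnihilator, Pi.add_apply, add_smul, Finset.sum_add_distrib]

/-- `v ↦ P_v` is homogeneous. Yang, Rev. Mod. Phys. 34 (1962) 694, §4. [folklore] -/
theorem pairAnnihilator_smul (c : ℂ) (v : ι × ι → ℂ) :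
    pairAnnihilator (c • v) = c • pairAnnihilator v := by
  simp only [pairAnnihilator, Pi.smul_apply, smul_eq_mul, mul_smul, Finset.smul_sum]

end Geminal

section TorusSums

variable {L : ℕ} [NeZero L]

/-- Sums over the Hubbard orbitals of the fermionic torus, reindexed by torus site and spin through
`FermionTorus.equivTorusSite` and `orb` (bookkeeping). Friedli–Velenik (2017), §3.1. [folklore] -/
theorem sum_orb_fermionTorus {M : Type*} [AddCommMonoid M] {d : ℕ}
    (f : Orb (FermionTorus d L) → M) :
    ∑ o, f o = ∑ x : TorusSite d L, ∑ σ : Fin 2, f (orb (FermionTorus.ofTorusSite x) σ) := by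
  rw [← (toLex : FermionTorus d L × Fin 2 ≃ Orb (FermionTorus d L)).sum_comp,
    Fintype.sum_prod_type,
    ← (FermionTorus.equivTorusSite (d := d) (L := L)).symm.sum_comp]
  rfl

/-- `Torus.proj` commutes with negation (it is additive).
Friedli–Velenik (2017), §3.1. [folklore] -/
theorem Torus.proj_neg {d : ℕ} (L : ℕ) (e : Site d) : Torus.proj L (-e) = -Torus.proj L e := by
  funext i
  simp [Torus.proj]

end TorusSums

section PairFieldGeminal

variable (g : Site 2 → ℝ) (L : ℕ) [NeZero L]

omit [NeZero L] in
/-- `φ_g = Σ_{e ∈ {0} ∪ unitSteps} φ_{g,e}`, where the `e`-component `φ_{g,e}` is the pair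
wavefunction supported on pairs `(o₁, o₂)` with `x₂ = x₁ + e` on the torus and opposite spins.
Scalapino, Phys. Rep. 250 (1995) 329, §2, eq. (2.2)–(2.3). [folklore] -/
theorem pairFieldWavefunction_eq_sum_step :
    pairFieldWavefunction g L = ∑ e ∈ insert 0 unitSteps,
      (fun p : Orb (FermionTorus 2 L) × Orb (FermionTorus 2 L) =>
        if (ofLex p.2).1.toTorusSite = (ofLex p.1).1.toTorusSite + Torus.proj L e then
          (if (ofLex p.1).2 = 0 ∧ (ofLex p.2).2 = 1 then -((g e / Real.sqrt 2 : ℝ) : ℂ)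
            else if (ofLex p.1).2 = 1 ∧ (ofLex p.2).2 = 0 then ((g e / Real.sqrt 2 : ℝ) : ℂ)
            else 0)
        else 0) := by
  funext p
  simp only [pairFieldWavefunction, Finset.sum_apply]

/-- The geminal operator of the `e`-component: `P_{φ_{g,e}} = Σ_y (g e/√2) (c_{y↑} c_{y-e,↓} -
c_{y↓} c_{y-e,↑})` (reindex orbital pairs by sites and spins, collapse the Kronecker delta, and
translate `y = x + e`). No anticommutation relation is used.
Scalapino, Phys. Rep. 250 (1995) 329, §2, eq. (2.2). [folklore] -/
theorem pairAnnihilator_pairFieldWavefunctionStep (e : Site 2) :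
    pairAnnihilator (fun p : Orb (FermionTorus 2 L) × Orb (FermionTorus 2 L) =>
        if (ofLex p.2).1.toTorusSite = (ofLex p.1).1.toTorusSite + Torus.proj L e then
          (if (ofLex p.1).2 = 0 ∧ (ofLex p.2).2 = 1 then -((g e / Real.sqrt 2 : ℝ) : ℂ)
            else if (ofLex p.1).2 = 1 ∧ (ofLex p.2).2 = 0 then ((g e / Real.sqrt 2 : ℝ) : ℂ)
            else 0)
        else 0) =
      ∑ y : TorusSite 2 L, ((g e / Real.sqrt 2 : ℝ) : ℂ) •
        (annihilation (orb (FermionTorus.ofTorusSite y) 0) *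
            annihilation (orb (FermionTorus.ofTorusSite (y - Torus.proj L e)) 1) -
          annihilation (orb (FermionTorus.ofTorusSite y) 1) *
            annihilation (orb (FermionTorus.ofTorusSite (y - Torus.proj L e)) 0)) := by
  unfold pairAnnihilator
  rw [Fintype.sum_prod_type, sum_orb_fermionTorus]
  simp only [sum_orb_fermionTorus (d := 2) (L := L)]
  -- now: ∑ x₁, ∑ σ₁, ∑ x₂, ∑ σ₂, φ (orb x₁ σ₁, orb x₂ σ₂) • (c (orb x₂ σ₂) * c (orb x₁ σ₁))
  simp only [ofLex_toLex, FermionTorus.toTorusSite_ofTorusSite, Fin.sum_univ_two, Fin.isValue]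
  simp only [zero_ne_one, one_ne_zero, and_true, and_false, if_false, if_true,
    ite_smul, zero_smul, add_zero, zero_add, Finset.sum_add_distrib, Finset.sum_ite_eq',
    Finset.mem_univ]
  rw [← Finset.sum_add_distrib]
  refine Fintype.sum_equiv (Equiv.addRight (Torus.proj L e)) _ _ fun x => ?_
  simp only [Equiv.coe_addRight, add_sub_cancel_right, smul_sub, neg_smul]
  abel

/-- **`Δ_g = P_{φ_g}` for an even form factor.** For `g (-e) = g e` the pair field is the geminal
operator of `pairFieldWavefunction g L`: by `pairAnnihilator_pairFieldWavefunctionStep` the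
`e`-component of `P_{φ_g}` is the `(-e)`-summand of `Δ_g`, and `{0} ∪ unitSteps` is symmetric.
(For a general `g` the identity needs the anticommutation of annihilation operators; evenness
avoids it.) Scalapino, Phys. Rep. 250 (1995) 329, §2, eq. (2.2)–(2.3). [folklore] -/
theorem pairField_eq_pairAnnihilator_of_even (hg : ∀ e, g (-e) = g e) :
    pairField_eq_pairAnnihilator g L := by
  unfold pairField_eq_pairAnnihilator
  rw [pairFieldWavefunction_eq_sum_step, pairAnnihilator_sum]
  simp only [pairAnnihilator_pairFieldWavefunctionStep]
  unfold pairField localPair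
  rw [Finset.sum_comm]
  refine Finset.sum_equiv (Equiv.neg (Site 2)) (fun i => ?_) (fun i _ => ?_)
  · simp only [Finset.mem_insert, unitSteps, Finset.mem_singleton, Equiv.neg_apply,
      neg_eq_iff_eq_neg, neg_zero, neg_neg]
    tauto
  · simp only [Equiv.neg_apply, hg, Torus.proj_neg, sub_neg_eq_add]

/-- The `d_{x²-y²}` form factor is even.
Scalapino, Phys. Rep. 250 (1995) 329, §2, eq. (2.3). [folklore] -/
theorem dWaveFormFactor_neg (e : Site 2) : dWaveFormFactor (-e) = dWaveFormFactor e := by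
  simp only [dWaveFormFactor, neg_eq_iff_eq_neg, neg_neg]
  exact if_congr or_comm rfl (if_congr or_comm rfl rfl)

/-- `Δ_d = P_{φ_d}`: discharge of the named fact `pairField_eq_pairAnnihilator` for the `d`-wave
form factor. Scalapino, Phys. Rep. 250 (1995) 329, §2, eq. (2.2)–(2.3). [cite: Scalapino1995, §2] -/
theorem pairField_eq_pairAnnihilator_dWave : pairField_eq_pairAnnihilator dWaveFormFactor L :=
  pairField_eq_pairAnnihilator_of_even dWaveFormFactor L dWaveFormFactor_neg

end PairFieldGeminal

/-! ### `ℓ²` norms of Fock vectors -/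

section Norms

/-- `star a ⬝ᵥ b` is the inner product of `ℓ²(n)` (Mathlib `EuclideanSpace`). [folklore] -/
theorem star_dotProduct_eq_inner {n : Type*} [Fintype n] (a b : n → ℂ) :
    star a ⬝ᵥ b = ⟪(WithLp.toLp 2 a : EuclideanSpace ℂ n), WithLp.toLp 2 b⟫_ℂ := by
  rw [EuclideanSpace.inner_eq_star_dotProduct, dotProduct_comm]

/-- Cauchy–Schwarz for `re (star a ⬝ᵥ b)` in terms of `ℓ²` norms. [folklore] -/
theorem re_star_dotProduct_le_norm_mul_norm {n : Type*} [Fintype n] (a b : n → ℂ) :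
    (star a ⬝ᵥ b).re ≤
      ‖(WithLp.toLp 2 a : EuclideanSpace ℂ n)‖ * ‖(WithLp.toLp 2 b : EuclideanSpace ℂ n)‖ := by
  rw [star_dotProduct_eq_inner]
  exact (Complex.re_le_norm _).trans (norm_inner_le_norm _ _)

/-- `‖a‖²_{ℓ²} = re (star a ⬝ᵥ a)`. [folklore] -/
theorem norm_toLp_sq_eq_re {n : Type*} [Fintype n] (a : n → ℂ) :
    ‖(WithLp.toLp 2 a : EuclideanSpace ℂ n)‖ ^ 2 = (star a ⬝ᵥ a).re := by
  rw [star_dotProduct_eq_inner, ← inner_self_eq_norm_sq (𝕜 := ℂ)]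
  rfl

variable {ι : Type*} [LinearOrder ι] [Fintype ι]

/-- Annihilation operators are contractions: `‖c_i φ‖ ≤ ‖φ‖` (because `c†_i c_i = n_i` is a
`0/1`-diagonal matrix, `numberAt_eq_diagonal`). Bratteli–Robinson II §5.2.2, Prop. 5.2.2
(`‖a(f)‖ = ‖f‖`). [folklore] -/
theorem norm_toLp_annihilation_mulVec_le (i : ι) (φ : Fock ι) :
    ‖(WithLp.toLp 2 (annihilation i *ᵥ φ) : EuclideanSpace ℂ (Finset ι))‖ ≤
      ‖(WithLp.toLp 2 φ : EuclideanSpace ℂ (Finset ι))‖ := by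
  refine le_of_pow_le_pow_left₀ two_ne_zero (norm_nonneg _) ?_
  rw [norm_toLp_sq_eq_re, norm_toLp_sq_eq_re, ← PosSemidefTrace.expect_conjTranspose_mul,
    annihilation_conjTranspose, show creation i * annihilation i = numberAt i from rfl,
    numberAt_eq_diagonal]
  simp only [QuantumLattice.expect, mulVec_diagonal, dotProduct, Pi.star_apply, Complex.re_sum]
  refine Finset.sum_le_sum fun s _ => ?_
  split_ifs
  · simp
  · rw [zero_mul, mul_zero, Complex.zero_re, Complex.star_def, Complex.conj_mul']
    norm_cast
    positivity

end Norms

/-! ### From eventual bounds to `HasTorusLRO` -/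

section TorusLRO

variable {d : ℕ}

/-- A sum over the fundamental domain `halfOpenBox d L` of a function of `Torus.proj L x` is the
sum over the torus (`torusProj_bijOn_halfOpenBox`). Friedli–Velenik (2017), §3.1. [folklore] -/
theorem sum_halfOpenBox_torusProj {M : Type*} [AddCommMonoid M] (L : ℕ) [NeZero L]
    (f : TorusSite d L → M) :
    ∑ x ∈ halfOpenBox d L, f (Torus.proj L x) = ∑ x : TorusSite d L, f x := by
  have h := torusProj_bijOn_halfOpenBox (d := d) L
  exact Finset.sum_nbij (Torus.proj L) (fun a _ => Finset.mem_univ _) h.injOn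
    (by simpa using h.surjOn) (fun _ _ => rfl)

/-- **LRO from eventual two-sided bounds.** If eventually (in the side `L + 1`)
`a (L+1)^{2d} ≤ Σ_{x,y} G_{L+1}(x,y)` with `a > 0`, and the two-point function is eventually
bounded above pointwise (which keeps the real `liminf` away from its junk value), then
`HasTorusLRO G`. Friedli–Velenik (2017), §3.7.2, Definition 3.27. [folklore] -/
theorem hasTorusLRO_of_eventually_le (G : (L : ℕ) → TorusSite d L → TorusSite d L → ℝ)
    {a b : ℝ} (ha : 0 < a)
    (hlow : ∀ᶠ L : ℕ in atTop,
      a * ((L + 1 : ℕ) : ℝ) ^ (2 * d) ≤ ∑ x : TorusSite d (L + 1), ∑ y, G (L + 1) x y)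
    (hup : ∀ᶠ L : ℕ in atTop, ∀ x y : TorusSite d (L + 1), G (L + 1) x y ≤ b) :
    HasTorusLRO G := by
  unfold HasTorusLRO HasLongRangeOrder
  rw [← Filter.liminf_nat_add _ 1]
  have hpos : ∀ L : ℕ, (0 : ℝ) < ((L + 1 : ℕ) : ℝ) ^ (2 * d) := fun L => by positivity
  have key : ∀ L : ℕ,
      (∑ x ∈ halfOpenBox d (L + 1), ∑ y ∈ halfOpenBox d (L + 1),
          torusPullback G (L + 1) x y) / ((#(halfOpenBox d (L + 1)) : ℝ)) ^ 2 =
        (∑ x : TorusSite d (L + 1), ∑ y, G (L + 1) x y) / ((L + 1 : ℕ) : ℝ) ^ (2 * d) := by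
    intro L
    rw [card_halfOpenBox, Nat.cast_pow, ← pow_mul, mul_comm d 2]
    congr 1
    simp only [torusPullback_apply]
    rw [sum_halfOpenBox_torusProj (L + 1)
      (fun x => ∑ y ∈ halfOpenBox d (L + 1), G (L + 1) x (Torus.proj (L + 1) y))]
    exact Finset.sum_congr rfl fun x _ => sum_halfOpenBox_torusProj (L + 1) fun y => G (L + 1) x y
  simp only [key]
  refine lt_of_lt_of_le ha (le_liminf_of_le ?_ ?_)
  · refine isCoboundedUnder_ge_of_eventually_le _ (x := b) ?_
    filter_upwards [hup] with L hL
    rw [div_le_iff₀ (hpos L)]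
    calc ∑ x : TorusSite d (L + 1), ∑ y : TorusSite d (L + 1), G (L + 1) x y
        ≤ ∑ x : TorusSite d (L + 1), ∑ y : TorusSite d (L + 1), b :=
          Finset.sum_le_sum fun x _ => Finset.sum_le_sum fun y _ => hL x y
      _ = b * ((L + 1 : ℕ) : ℝ) ^ (2 * d) := by
          simp only [Finset.sum_const, Finset.card_univ, Fintype.card_pi, ZMod.card,
            Finset.prod_const, Fintype.card_fin]
          push_cast
          ring
  · filter_upwards [hlow] with L hL
    rwa [le_div_iff₀ (hpos L)]

end TorusLRO


/-! ### Bounding the pair-field two-point function; the Q-D5 bridge -/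

section PairFieldBounds

variable (g : Site 2 → ℝ)

/-- The crude bound `C_g = Σ_{e ∈ {0} ∪ unitSteps} 2 |g e| / √2` for `‖P_x‖` is nonnegative.
Scalapino, Phys. Rep. 250 (1995) 329, §2. [folklore] -/
theorem localPairNormBound_nonneg :
    0 ≤ (∑ e ∈ insert 0 unitSteps, ‖((g e / Real.sqrt 2 : ℝ) : ℂ)‖ * 2) :=
  Finset.sum_nonneg fun _ _ => by positivity

variable (L : ℕ) [NeZero L]

/-- `‖P_x ψ‖ ≤ C_g ‖ψ‖` with `C_g = Σ_{e ∈ {0} ∪ unitSteps} 2 |g e| / √2` (each of the two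
products of two annihilation operators in `localPair` is a contraction). Scalapino, Phys. Rep.
250 (1995) 329, §2; Bratteli–Robinson II §5.2.2. [folklore] -/
theorem norm_toLp_localPair_mulVec_le (x : TorusSite 2 L) (ψ : Fock (Orb (FermionTorus 2 L))) :
    ‖(WithLp.toLp 2 (localPair g L x *ᵥ ψ) : EuclideanSpace ℂ (Finset (Orb (FermionTorus 2 L))))‖ ≤
      (∑ e ∈ insert 0 unitSteps, ‖((g e / Real.sqrt 2 : ℝ) : ℂ)‖ * 2) *
        ‖(WithLp.toLp 2 ψ : EuclideanSpace ℂ (Finset (Orb (FermionTorus 2 L))))‖ := by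
  unfold localPair
  simp only [Matrix.sum_mulVec, Matrix.smul_mulVec, Matrix.sub_mulVec, ← Matrix.mulVec_mulVec,
    WithLp.toLp_sum, WithLp.toLp_smul, WithLp.toLp_sub]
  rw [Finset.sum_mul]
  refine (norm_sum_le _ _).trans (Finset.sum_le_sum fun e _ => ?_)
  rw [norm_smul, mul_assoc]
  refine mul_le_mul_of_nonneg_left ((norm_sub_le _ _).trans ?_) (norm_nonneg _)
  rw [two_mul]
  exact add_le_add
    ((norm_toLp_annihilation_mulVec_le _ _).trans (norm_toLp_annihilation_mulVec_le _ _))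
    ((norm_toLp_annihilation_mulVec_le _ _).trans (norm_toLp_annihilation_mulVec_le _ _))

end PairFieldBounds

section PairFieldSums

variable (g : Site 2 → ℝ) (ψ : ∀ L, Fock (Orb (FermionTorus 2 L)))

/-- The pair-field two-point function of a normalised state is bounded by `C_g²`.
Scalapino, Phys. Rep. 250 (1995) 329, §2. [folklore] -/
theorem pairFieldCorr_succ_le (L : ℕ) (hψ : star (ψ (L + 1)) ⬝ᵥ ψ (L + 1) = 1)
    (x y : TorusSite 2 (L + 1)) :
    pairFieldCorr g ψ (L + 1) x y ≤
      (∑ e ∈ insert 0 unitSteps, ‖((g e / Real.sqrt 2 : ℝ) : ℂ)‖ * 2) ^ 2 := by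
  rw [pairFieldCorr_succ, PosSemidefTrace.expect_conjTranspose_mul]
  have h1 : ‖(WithLp.toLp 2 (ψ (L + 1)) : EuclideanSpace ℂ (Finset (Orb (FermionTorus 2 (L + 1)))))‖
      = 1 := by
    have h := norm_toLp_sq_eq_re (ψ (L + 1))
    rw [hψ, Complex.one_re] at h
    exact (pow_eq_one_iff_of_nonneg (norm_nonneg _) two_ne_zero).1 h
  refine (re_star_dotProduct_le_norm_mul_norm _ _).trans ?_
  rw [sq]
  refine mul_le_mul ?_ ?_ (norm_nonneg _) (localPairNormBound_nonneg g)
  · simpa [h1] using norm_toLp_localPair_mulVec_le g (L + 1) x (ψ (L + 1))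
  · simpa [h1] using norm_toLp_localPair_mulVec_le g (L + 1) y (ψ (L + 1))

/-- `Σ_{x,y} G_{L+1}(x,y) = re ⟨ψ, Δ_g† Δ_g ψ⟩` (bilinearity).
Scalapino, Phys. Rep. 250 (1995) 329, §2, eq. (2.4). [folklore] -/
theorem sum_pairFieldCorr_succ (L : ℕ) :
    ∑ x : TorusSite 2 (L + 1), ∑ y, pairFieldCorr g ψ (L + 1) x y =
      (expect ((pairField g (L + 1))ᴴ * pairField g (L + 1)) (ψ (L + 1))).re := by
  simp only [pairFieldCorr_succ, pairField, conjTranspose_sum, Finset.sum_mul, Finset.mul_sum,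
    expect_sum, Complex.re_sum]
  exact Finset.sum_comm

/-- Discharge of the named fact `expect_pairField_conjTranspose_mul`:
`⟨Δ_g† Δ_g⟩ = Σ_{x,y} ⟨(P_x)ᴴ P_y⟩`.
Scalapino, Phys. Rep. 250 (1995) 329, §2. [cite: Scalapino1995, §2] -/
theorem expect_pairField_conjTranspose_mul_holds (L : ℕ) [NeZero L] :
    expect_pairField_conjTranspose_mul g L := by
  intro φ
  simp only [pairField, conjTranspose_sum, Finset.sum_mul, Finset.mul_sum, expect_sum]
  exact Finset.sum_comm

end PairFieldSums

section BridgeProof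

variable {ι : Type*} [LinearOrder ι] [Fintype ι]

/-- `ρ₂` is the Gram matrix of `u ↦ P_u ψ`: `x† ρ₂ y = ⟨P_x ψ, P_y ψ⟩`.
Yang, Rev. Mod. Phys. 34 (1962) 694, §4, eq. (22). [folklore] -/
theorem star_dotProduct_twoParticleRDM_mulVec (ψ : Fock ι) (x y : ι × ι → ℂ) :
    star x ⬝ᵥ (twoParticleRDM ψ *ᵥ y) =
      star (pairAnnihilator x *ᵥ ψ) ⬝ᵥ (pairAnnihilator y *ᵥ ψ) := by
  rw [← expect_pairAnnihilator_conjTranspose_mul_pairAnnihilator,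
    PosSemidefTrace.expect_conjTranspose_mul]

/-- **Discharge of the Q-D5 bridge `hasPairFieldLRO_dWave_of_hasODLRO`.** For `L` in the
eventual range of the hypotheses, `Σ_{x,y} G_{L+1}(x,y) = re ⟨Δ_d† Δ_d⟩ = re (φ_d† ρ₂ φ_d)`
(`sum_pairFieldCorr_succ`, `pairField_eq_pairAnnihilator_dWave`, polarised Yang identity)
`≥ λ |⟨v, φ_d⟩|²` (`re_dotProduct_mulVec_ge_of_eigenvector`) `≥ (c N(L+1)) (c (L+1)²) ≥
c² δ (L+1)⁴`; together with the a-priori bound `G ≤ C_d²` (`pairFieldCorr_succ_le`) this gives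
`HasTorusLRO` (`hasTorusLRO_of_eventually_le`). Yang, Rev. Mod. Phys. 34 (1962) 694, §4;
Scalapino, Phys. Rep. 250 (1995) 329, §2. [cite: Scalapino1995, §2] -/
theorem hasPairFieldLRO_dWave_of_hasODLRO_holds : hasPairFieldLRO_dWave_of_hasODLRO := by
  intro N ψ hnorm hN hv
  refine ⟨hnorm, ?_⟩
  obtain ⟨δ, hδ, hN⟩ := hN
  obtain ⟨c, hc, hv⟩ := hv
  have hN' : ∀ᶠ L : ℕ in atTop, δ * ((L + 1 : ℕ) : ℝ) ^ 2 ≤ N (L + 1) :=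
    (tendsto_add_atTop_nat 1).eventually hN
  refine hasTorusLRO_of_eventually_le (pairFieldCorr dWaveFormFactor ψ) (a := c * c * δ)
    (b := (∑ e ∈ insert 0 unitSteps, ‖((dWaveFormFactor e / Real.sqrt 2 : ℝ) : ℂ)‖ * 2) ^ 2)
    (by positivity) ?_
    (Eventually.of_forall fun L => pairFieldCorr_succ_le dWaveFormFactor ψ L (hnorm (L + 1)).2)
  filter_upwards [hN', hv] with L hNL hvL
  obtain ⟨v, ev, hv1, -, hev, hcN, hov⟩ := hvL
  rw [sum_pairFieldCorr_succ, expect_pairField_eq_dotProduct_twoParticleRDM dWaveFormFactor (L + 1)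
    expect_pairAnnihilator_conjTranspose_mul_holds (pairField_eq_pairAnnihilator_dWave (L + 1))]
  have hkey := re_dotProduct_mulVec_ge_of_eigenvector
    (fun u : Orb (FermionTorus 2 (L + 1)) × Orb (FermionTorus 2 (L + 1)) → ℂ =>
      pairAnnihilator u *ᵥ ψ (L + 1))
    (fun x y => by simp only [pairAnnihilator_add, add_mulVec])
    (fun a x => by simp only [pairAnnihilator_smul, smul_mulVec])
    (twoParticleRDM (ψ (L + 1))) (star_dotProduct_twoParticleRDM_mulVec (ψ (L + 1))) v
    (pairFieldWavefunction dWaveFormFactor (L + 1)) ev hv1 hev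
  have hcL : (0 : ℝ) ≤ c * ((L + 1 : ℕ) : ℝ) ^ 2 := by positivity
  have hev0 : (0 : ℝ) ≤ ev := le_trans (by positivity) hcN
  calc c * c * δ * ((L + 1 : ℕ) : ℝ) ^ (2 * 2)
      = (c * (δ * ((L + 1 : ℕ) : ℝ) ^ 2)) * (c * ((L + 1 : ℕ) : ℝ) ^ 2) := by ring
    _ ≤ (c * (N (L + 1) : ℝ)) * (c * ((L + 1 : ℕ) : ℝ) ^ 2) := by gcongr
    _ ≤ ev * ‖star v ⬝ᵥ pairFieldWavefunction dWaveFormFactor (L + 1)‖ ^ 2 :=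
        mul_le_mul hcN hov hcL hev0
    _ ≤ _ := hkey

end BridgeProof

/-! ### Unfolding pair-field LRO to the textbook `liminf` -/

section LiminfUnfolding

variable (g : Site 2 → ℝ) (ψ : ∀ L, Fock (Orb (FermionTorus 2 L)))

/-- The term of side `L + 1` of the sequence defining `HasTorusLRO (pairFieldCorr g ψ)` is
`(L+1)⁻⁴ re ⟨ψ_{L+1}, Δ_g† Δ_g ψ_{L+1}⟩`: the fundamental domain `halfOpenBox 2 (L+1)` is
reindexed by the torus (`sum_halfOpenBox_torusProj`), `|Λ_{L+1}|² = ((L+1)²)² = (L+1)⁴`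
(`card_halfOpenBox`), and `Σ_{x,y} G_{L+1}(x,y) = re ⟨Δ_g† Δ_g⟩` (`sum_pairFieldCorr_succ`).
Scalapino, Phys. Rep. 250 (1995) 329, §2, eq. (2.4); Friedli–Velenik (2017), §3.7.2. [folklore] -/
theorem torusLROSeq_pairFieldCorr_succ (L : ℕ) :
    (∑ x ∈ halfOpenBox 2 (L + 1), ∑ y ∈ halfOpenBox 2 (L + 1),
        torusPullback (pairFieldCorr g ψ) (L + 1) x y) / ((#(halfOpenBox 2 (L + 1)) : ℝ)) ^ 2 =
      (expect ((pairField g (L + 1))ᴴ * pairField g (L + 1)) (ψ (L + 1))).re /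
        ((L + 1 : ℕ) : ℝ) ^ 4 := by
  rw [card_halfOpenBox, Nat.cast_pow, ← pow_mul, ← sum_pairFieldCorr_succ]
  congr 1
  simp only [torusPullback_apply]
  rw [sum_halfOpenBox_torusProj (L + 1)
    (fun x => ∑ y ∈ halfOpenBox 2 (L + 1), pairFieldCorr g ψ (L + 1) x (Torus.proj (L + 1) y))]
  exact Finset.sum_congr rfl fun x _ =>
    sum_halfOpenBox_torusProj (L + 1) fun y => pairFieldCorr g ψ (L + 1) x y

/-- The `liminf` defining `HasTorusLRO (pairFieldCorr g ψ)` (G02 convention, normalisation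
`|Λ_L|⁻²`) equals the textbook `liminf_{L → ∞} L⁻⁴ re ⟨ψ_L, Δ_g† Δ_g ψ_L⟩` written with the
index shifted to `L + 1`; the shift does not change a `liminf` along `atTop`
(`Filter.liminf_nat_add`). Scalapino, Phys. Rep. 250 (1995) 329, §2, eq. (2.4);
Friedli–Velenik (2017), §3.7.2, eq. (3.41). [folklore] -/
theorem liminf_torusLROSeq_pairFieldCorr :
    liminf (fun L : ℕ => (∑ x ∈ halfOpenBox 2 L, ∑ y ∈ halfOpenBox 2 L,
        torusPullback (pairFieldCorr g ψ) L x y) / ((#(halfOpenBox 2 L) : ℝ)) ^ 2) atTop =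
      liminf (fun L : ℕ =>
        (expect ((pairField g (L + 1))ᴴ * pairField g (L + 1)) (ψ (L + 1))).re /
          ((L + 1 : ℕ) : ℝ) ^ 4) atTop := by
  rw [← Filter.liminf_nat_add (fun L : ℕ => (∑ x ∈ halfOpenBox 2 L, ∑ y ∈ halfOpenBox 2 L,
        torusPullback (pairFieldCorr g ψ) L x y) / ((#(halfOpenBox 2 L) : ℝ)) ^ 2) 1]
  simp only [torusLROSeq_pairFieldCorr_succ]

/-- **Discharge of the named fact `hasPairFieldLRO_iff_liminf`**: `HasPairFieldLRO g N ψ` is the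
normalisation/particle-number clause together with
`0 < liminf_{L → ∞} (L+1)⁻⁴ re ⟨ψ_{L+1}, Δ_g† Δ_g ψ_{L+1}⟩`. Both sides carry the same first
clause, and the two `liminf`s are *equal* real numbers (`liminf_torusLROSeq_pairFieldCorr`), so the
equivalence is unconditional (no boundedness hypothesis is needed).
Scalapino, Phys. Rep. 250 (1995) 329, §2, eq. (2.4). [cite: Scalapino1995, §2 eq. (2.4)] -/
theorem hasPairFieldLRO_iff_liminf_holds : hasPairFieldLRO_iff_liminf := by
  intro g N ψ
  unfold HasPairFieldLRO HasTorusLRO HasLongRangeOrder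
  rw [liminf_torusLROSeq_pairFieldCorr]

end LiminfUnfolding

end Literature.MathematicalPhysics.QuantumLattice

/-! ### Every Rayleigh quotient is bounded by `Matrix.supRayleigh` -/

namespace Matrix

variable {m : Type*} [Fintype m]

/-- A vector with `v† v = 1` (in the `dotProduct` normalisation of `Matrix.supRayleigh`) has all
components of norm at most `1`: `‖v i‖² ≤ Σ_k ‖v k‖² = re (v† v) = 1`. [folklore] -/
theorem norm_apply_le_one_of_star_dotProduct_self_eq_one {v : m → ℂ} (hv : star v ⬝ᵥ v = 1)
    (i : m) : ‖v i‖ ≤ 1 := by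
  have hsum : ∑ k, ‖v k‖ ^ 2 = (1 : ℝ) := by
    have h := congrArg Complex.re hv
    simp only [dotProduct, Pi.star_apply, Complex.star_def, Complex.conj_mul', Complex.re_sum,
      Complex.one_re] at h
    simpa [← Complex.ofReal_pow, Complex.ofReal_re] using h
  have h : ‖v i‖ ^ 2 ≤ 1 := by
    rw [← hsum]
    exact Finset.single_le_sum (f := fun k => ‖v k‖ ^ 2) (fun k _ => sq_nonneg _)
      (Finset.mem_univ i)
  exact (sq_le_one_iff₀ (norm_nonneg _)).mp h

/-- Entrywise bound on a unit-vector Rayleigh quotient: if `v† v = 1` then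
`re (v† ρ v) ≤ |v† ρ v| ≤ Σ_i ‖v i‖ Σ_j ‖ρ i j‖ ‖v j‖ ≤ Σ_{i,j} ‖ρ i j‖`. [folklore] -/
theorem re_star_dotProduct_mulVec_le_sum_norm (ρ : Matrix m m ℂ) (v : m → ℂ)
    (hv : star v ⬝ᵥ v = 1) : (star v ⬝ᵥ (ρ *ᵥ v)).re ≤ ∑ i, ∑ j, ‖ρ i j‖ := by
  have hvi := norm_apply_le_one_of_star_dotProduct_self_eq_one hv
  calc (star v ⬝ᵥ (ρ *ᵥ v)).re ≤ ‖star v ⬝ᵥ (ρ *ᵥ v)‖ := Complex.re_le_norm _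
    _ ≤ ∑ i, ‖star v i * (ρ *ᵥ v) i‖ := norm_sum_le _ _
    _ ≤ ∑ i, ∑ j, ‖ρ i j‖ := Finset.sum_le_sum fun i _ => ?_
  have h1 : ‖∑ j, ρ i j * v j‖ ≤ ∑ j, ‖ρ i j‖ := by
    refine (norm_sum_le _ _).trans (Finset.sum_le_sum fun j _ => ?_)
    rw [norm_mul]
    exact mul_le_of_le_one_right (norm_nonneg _) (hvi j)
  rw [norm_mul, Pi.star_apply, norm_star]
  calc ‖v i‖ * ‖(ρ *ᵥ v) i‖ ≤ 1 * ∑ j, ‖ρ i j‖ :=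
      mul_le_mul (hvi i) h1 (norm_nonneg _) zero_le_one
    _ = ∑ j, ‖ρ i j‖ := one_mul _

/-- The set of unit-vector Rayleigh quotients `{re (v† ρ v) | v† v = 1}` of a square complex
matrix is bounded above (by `Σ_{i,j} ‖ρ i j‖`), so `Matrix.supRayleigh ρ` is a genuine supremum
(a maximum over the compact unit sphere; only boundedness is needed here). [folklore] -/
theorem bddAbove_range_rayleigh (ρ : Matrix m m ℂ) :
    BddAbove (Set.range fun v : {v : m → ℂ // star v ⬝ᵥ v = 1} =>
      (star v.1 ⬝ᵥ (ρ *ᵥ v.1)).re) :=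
  ⟨∑ i, ∑ j, ‖ρ i j‖, by
    rintro _ ⟨v, rfl⟩
    exact re_star_dotProduct_mulVec_le_sum_norm ρ v.1 v.2⟩

/-- **Discharge of `Matrix.rayleigh_le_supRayleigh`.** Every unit-vector Rayleigh quotient
`re (v† ρ v)`, `v† v = 1`, is at most `ρ.supRayleigh = sup_{w† w = 1} re (w† ρ w)`: `le_ciSup`
on the bounded range `bddAbove_range_rayleigh`. This is the elementary half of the variational
characterisation of the largest eigenvalue used by Yang for `ρ₂`
(Yang, Rev. Mod. Phys. 34 (1962) 694, §4: `v† ρ₂ v ≤ λ_max` for normalised pair wavefunctions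
`v`); no Hermiticity is needed for this direction. [cite: Yang1962, §4] -/
theorem rayleigh_le_supRayleigh_holds : rayleigh_le_supRayleigh (m := m) := by
  intro ρ v hv
  exact le_ciSup (bddAbove_range_rayleigh ρ) ⟨v, hv⟩

end Matrix
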